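import Literature.MathematicalPhysics.QuantumFieldTheory.Balaban1983to89.Beta.KernelWard
import Literature.MathematicalPhysics.QuantumFieldTheory.Balaban1983to89.Beta.KernelReflection
import Literature.MathematicalPhysics.QuantumFieldTheory.Balaban1983to89.Beta.HessKerSchurResolvent

/-!
# `BalabanUV.Beta.TameKernelCalculus` — a tame trace calculus for matrix-fibred lattice kernels in EXISTENTIAL currency
# (β sub-cell, row BETA-an5, gen 18; file 1 of 3 of the chart-conjugation leaf `ChartConjugation` / `ChartConjugationEnd`)

HONEST FRAMING (cell contract, verbatim): «discharging `BetaPertH` makes Bałaban's UV stability UNCONDITIONAL — a real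
constructive-QFT result; it is NOT the continuum limit and NOT the Clay problem.»  THIS MODULE is elementary analysis (absolutely
convergent lattice sums): it formalises NO printed statement, cites nothing as a hypothesis, mints no `Prop` FACT (its five
`def … : Prop` are PREDICATES on kernels — classes, like `KernelWard.Bdd` / `ExpKernelCalculus.Decays`), DISCHARGES NOTHING of the wall.
NOT summit progress.

ABSOLUTE RULE (cell, verbatim): «No internally-minted statement may enter as a cited fact. Every hypothesis is either
kernel-proved in this package or a verbatim quotation of a PUBLISHED theorem with page reference. The manuscript(s) under
audit are NOT citable for their own disputed steps — they are the thing under adjudication; programme-internal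
(2001/route/tribunal) claims are never citable.»  Every theorem below is kernel-proved from explicit hypotheses.

PLACEMENT.  Our own lemmas about the cell's typed objects (β-lead RULINGS (R34-A), (R33-A-2′)): cell topic
`Summits/QuantumFields/BalabanUV/Beta/`; imports `Literature/…/Balaban1983to89/Beta/` leaves only; imported by nothing under `Literature/`.

WHY.  The chart-conjugation identity (`ChartConjugation.conj_defect`, X-an2-40 §5 (iii)) is forty-odd re-associations
`A∘(K∘L) = (A∘K)∘L` and trace cyclicities `tr(K∘L) = tr(L∘K)` of infinite lattice sums, each CONDITIONAL on absolute convergence.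
The tree's bricks (`KernelWard.comp_assoc_of_bound`, `tr_comp_comm_of_bound`, `comp_sub_*`, `tr_sub`) take explicit majorants /
slice summabilities; the typed instances (`comp_assoc_dbb/_bdb`, `tr_comp_comm_bb`) fix one class pattern and one common rate each.
This file packages them ONCE in a currency in which rates and constants never have to be matched by hand: §1 classes `RowMaj` /
`ColMaj` (summable row / column majorants), `Tame := RowMaj ∧ ColMaj ∧ bounded`, the existential classes `Spr A :↔ ∃ C δ > 0, Decays A C δ`
(SPREAD: resolvents, the bordered Hessian, `idK`) and `Loc K :↔ ∃ p q C δ > 0, BiLoc K p q C δ` (LOCALISED: vertices, tables, contacts), their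
tameness and closure (`Spr.comp_loc`, `Loc.comp_spr`, `Loc.comp`, `Loc.add/sub/neg/smul`, transpose `trK`); §2 bricks `slice(s)_tame`,
**`comp_assoc_tame`** (three tame factors), **`tr_comp_comm_loc`** (one localised, one tame factor), `comp_add/sub_left/right_tame`,
`comp_neg_left/right` (termwise), `tr_add/sub_loc`, `tadpole_add`, `bubble_add_left/right`.

RELATION TO THE TREE (no duplication): every brick is a COROLLARY of the named `KernelWard` / `ExpKernelCalculus` / `KernelReflection` /
`HessKerSchurResolvent` lemma, USED BY NAME; nothing is re-proved from scratch except the three-line rate-lowering lemmas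
`decays_of_le` / `biLoc_of_le` (the tree's `OneStepResolventKernel.decays_mono` / `biLoc_mono` are typed at dimension `d + 1` only).
NOT continuum, NOT Clay.
-/

open Finset
open scoped BigOperators
open Literature.MathematicalPhysics.QuantumFieldTheory.Balaban1983to89
open Literature.MathematicalPhysics.QuantumFieldTheory.Balaban1983to89.Beta
open B12Sec2to5 (l1 l1_nonneg)
open ExpKernelCalculus (MKer Decays BiLoc comp tr bubble tadpole hess summable_exp_shift summable_exp_shift' biLoc_comp_decays
  biLoc_comp_biLoc summable_trTerm l1_sub_triangle)
open KernelWard (Bdd bdd_of_decays bdd_of_biLoc biLoc_recentre biLoc_add biLoc_sub comp_sub_left comp_sub_right tr_sub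
  comp_assoc_of_bound tr_comp_comm_of_bound)
open KernelReflection (comp_smul_left comp_smul_right tr_smul)
open HessKerSchurResolvent (idK idK_apply comp_idK_left comp_idK_right)

namespace Summit.QuantumFields.BalabanUV.Beta.TameKernelCalculus

noncomputable section

variable {D : ℕ} {F : Type*} [Fintype F]

/-! ## §1 Classes and closure -/

omit [Fintype F] in
/-- ROW MAJORANT: every row is dominated, uniformly in the fibre indices, by a summable nonnegative function of the column site. -/
def RowMaj (K : MKer D F) : Prop :=
  ∀ x, ∃ φ : (Fin D → ℤ) → ℝ, Summable φ ∧ (∀ y, 0 ≤ φ y) ∧ ∀ y a f, |K x y a f| ≤ φ y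

omit [Fintype F] in
/-- COLUMN MAJORANT: every column is dominated, uniformly in the fibre indices, by a summable nonnegative function of the row site. -/
def ColMaj (K : MKer D F) : Prop :=
  ∀ z, ∃ ψ : (Fin D → ℤ) → ℝ, Summable ψ ∧ (∀ y, 0 ≤ ψ y) ∧ ∀ y f b, |K y z f b| ≤ ψ y

omit [Fintype F] in
/-- TAME kernel: summable row and column majorants and a uniform bound. -/
def Tame (K : MKer D F) : Prop := RowMaj K ∧ ColMaj K ∧ ∃ B, Bdd K B

omit [Fintype F] in
/-- SPREAD kernel: `Decays` at some positive rate (translation-spread: resolvents, the bordered Hessian, `idK`). -/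
def Spr (A : MKer D F) : Prop := ∃ C δ : ℝ, 0 < δ ∧ Decays A C δ

omit [Fintype F] in
/-- LOCALISED kernel: `BiLoc` at some pair of points at some positive rate (vertices, second-order tables, contacts). -/
def Loc (K : MKer D F) : Prop := ∃ (p q : Fin D → ℤ) (C δ : ℝ), 0 < δ ∧ BiLoc K p q C δ

omit [Fintype F] in
/-- Lowering the rate of a `Decays` bound. -/
theorem decays_of_le {A : MKer D F} {C δ δ' : ℝ} (h : Decays A C δ) (h1 : δ' ≤ δ) : Decays A (|C|) δ' := by
  intro x y a b
  refine (h x y a b).trans ?_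
  have : Real.exp (-δ * l1 (x - y)) ≤ Real.exp (-δ' * l1 (x - y)) :=
    Real.exp_le_exp.mpr (by nlinarith [l1_nonneg (x - y)])
  calc C * Real.exp (-δ * l1 (x - y)) ≤ |C| * Real.exp (-δ * l1 (x - y)) :=
        mul_le_mul_of_nonneg_right (le_abs_self C) (Real.exp_pos _).le
    _ ≤ |C| * Real.exp (-δ' * l1 (x - y)) := mul_le_mul_of_nonneg_left this (abs_nonneg C)

omit [Fintype F] in
/-- Lowering the rate of a `BiLoc` bound. -/
theorem biLoc_of_le {K : MKer D F} {p q : Fin D → ℤ} {C δ δ' : ℝ} (h : BiLoc K p q C δ) (h1 : δ' ≤ δ) :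
    BiLoc K p q (|C|) δ' := by
  intro x y a b
  refine (h x y a b).trans ?_
  have : Real.exp (-δ * (l1 (x - p) + l1 (y - q))) ≤ Real.exp (-δ' * (l1 (x - p) + l1 (y - q))) :=
    Real.exp_le_exp.mpr (by nlinarith [l1_nonneg (x - p), l1_nonneg (y - q)])
  calc C * Real.exp (-δ * (l1 (x - p) + l1 (y - q))) ≤ |C| * Real.exp (-δ * (l1 (x - p) + l1 (y - q))) :=
        mul_le_mul_of_nonneg_right (le_abs_self C) (Real.exp_pos _).le
    _ ≤ |C| * Real.exp (-δ' * (l1 (x - p) + l1 (y - q))) := mul_le_mul_of_nonneg_left this (abs_nonneg C)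

omit [Fintype F] in
/-- A spread kernel is tame. -/
theorem Spr.tame {A : MKer D F} (h : Spr A) : Tame A := by
  obtain ⟨C, δ, hδ, hA⟩ := h
  refine ⟨fun x => ⟨fun y => |C| * Real.exp (-δ * l1 (x - y)), (summable_exp_shift hδ x).mul_left _, fun y => by positivity,
      fun y a f => (hA x y a f).trans (mul_le_mul_of_nonneg_right (le_abs_self C) (Real.exp_pos _).le)⟩,
    fun z => ⟨fun y => |C| * Real.exp (-δ * l1 (y - z)), (summable_exp_shift' hδ z).mul_left _, fun y => by positivity,
      fun y f b => (hA y z f b).trans (mul_le_mul_of_nonneg_right (le_abs_self C) (Real.exp_pos _).le)⟩,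
    ⟨C, bdd_of_decays hA hδ.le⟩⟩

omit [Fintype F] in
/-- A localised kernel is tame. -/
theorem Loc.tame {K : MKer D F} (h : Loc K) : Tame K := by
  obtain ⟨p, q, C, δ, hδ, hK⟩ := h
  have hrow : ∀ x y a f, |K x y a f| ≤ |C| * Real.exp (-δ * l1 (y - q)) := fun x y a f =>
    (hK x y a f).trans (by
      calc C * Real.exp (-δ * (l1 (x - p) + l1 (y - q))) ≤ |C| * Real.exp (-δ * (l1 (x - p) + l1 (y - q))) :=
            mul_le_mul_of_nonneg_right (le_abs_self C) (Real.exp_pos _).le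
        _ ≤ |C| * Real.exp (-δ * l1 (y - q)) :=
            mul_le_mul_of_nonneg_left (Real.exp_le_exp.mpr (by nlinarith [l1_nonneg (x - p), hδ.le])) (abs_nonneg C))
  have hcol : ∀ y z f b, |K y z f b| ≤ |C| * Real.exp (-δ * l1 (y - p)) := fun y z f b =>
    (hK y z f b).trans (by
      calc C * Real.exp (-δ * (l1 (y - p) + l1 (z - q))) ≤ |C| * Real.exp (-δ * (l1 (y - p) + l1 (z - q))) :=
            mul_le_mul_of_nonneg_right (le_abs_self C) (Real.exp_pos _).le
        _ ≤ |C| * Real.exp (-δ * l1 (y - p)) :=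
            mul_le_mul_of_nonneg_left (Real.exp_le_exp.mpr (by nlinarith [l1_nonneg (z - q), hδ.le])) (abs_nonneg C))
  exact ⟨fun x => ⟨fun y => |C| * Real.exp (-δ * l1 (y - q)), (summable_exp_shift' hδ q).mul_left _, fun y => by positivity,
      fun y a f => hrow x y a f⟩,
    fun z => ⟨fun y => |C| * Real.exp (-δ * l1 (y - p)), (summable_exp_shift' hδ p).mul_left _, fun y => by positivity,
      fun y f b => hcol y z f b⟩,
    ⟨C, bdd_of_biLoc hK hδ.le⟩⟩

omit [Fintype F] in
/-- The Kronecker kernel is spread (constant `1`, any rate). -/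
theorem spr_idK [DecidableEq F] : Spr (idK : MKer D F) := by
  refine ⟨1, 1, one_pos, fun x y a b => ?_⟩
  rw [idK_apply]
  split_ifs with h
  · rw [h.1, sub_self]
    simp [l1]
  · simp only [abs_zero]
    positivity

/-- Spread ∘ localised is localised. -/
theorem Spr.comp_loc {A K : MKer D F} (hA : Spr A) (hK : Loc K) : Loc (comp A K) := by
  obtain ⟨C, δ₁, hδ₁, hA⟩ := hA
  obtain ⟨p, q, C', δ₂, hδ₂, hK⟩ := hK
  have hδ : 0 < min δ₁ δ₂ := lt_min hδ₁ hδ₂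
  have hA' := decays_of_le hA (min_le_left δ₁ δ₂)
  have hK' := biLoc_of_le hK (min_le_right δ₁ δ₂)
  exact ⟨p, q, _, min δ₁ δ₂ / 2, by linarith,
    biLoc_comp_decays hA' hK' (show 0 ≤ min δ₁ δ₂ / 2 by linarith) (show min δ₁ δ₂ / 2 < min δ₁ δ₂ by linarith)⟩

/-- Localised ∘ localised is localised. -/
theorem Loc.comp {K L : MKer D F} (hK : Loc K) (hL : Loc L) : Loc (comp K L) := by
  obtain ⟨p, p', C, δ₁, hδ₁, hK⟩ := hK
  obtain ⟨q', q, C', δ₂, hδ₂, hL⟩ := hL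
  have hδ : 0 < min δ₁ δ₂ := lt_min hδ₁ hδ₂
  have hK' := biLoc_of_le hK (min_le_left δ₁ δ₂)
  have hL' := biLoc_of_le hL (min_le_right δ₁ δ₂)
  exact ⟨p, q, _, _, hδ, biLoc_comp_biLoc hK' hL' hδ⟩

omit [Fintype F] in
/-- Sum of two localised kernels is localised. -/
theorem Loc.add {K L : MKer D F} (hK : Loc K) (hL : Loc L) : Loc (K + L) := by
  obtain ⟨p, q, C, δ₁, hδ₁, hK⟩ := hK
  obtain ⟨p', q', C', δ₂, hδ₂, hL⟩ := hL
  have hδ : 0 < min δ₁ δ₂ := lt_min hδ₁ hδ₂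
  have hK' := biLoc_of_le hK (min_le_left δ₁ δ₂)
  have hL' := biLoc_recentre (biLoc_of_le hL (min_le_right δ₁ δ₂)) hδ.le p q
  exact ⟨p, q, _, _, hδ, biLoc_add hK' hL'⟩

omit [Fintype F] in
/-- Difference of two localised kernels is localised. -/
theorem Loc.sub {K L : MKer D F} (hK : Loc K) (hL : Loc L) : Loc (K - L) := by
  obtain ⟨p, q, C, δ₁, hδ₁, hK⟩ := hK
  obtain ⟨p', q', C', δ₂, hδ₂, hL⟩ := hL
  have hδ : 0 < min δ₁ δ₂ := lt_min hδ₁ hδ₂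
  have hK' := biLoc_of_le hK (min_le_left δ₁ δ₂)
  have hL' := biLoc_recentre (biLoc_of_le hL (min_le_right δ₁ δ₂)) hδ.le p q
  exact ⟨p, q, _, _, hδ, biLoc_sub hK' hL'⟩

omit [Fintype F] in
/-- Negation of a localised kernel is localised. -/
theorem Loc.neg {K : MKer D F} (hK : Loc K) : Loc (-K) := by
  obtain ⟨p, q, C, δ, hδ, hK⟩ := hK
  exact ⟨p, q, C, δ, hδ, fun x y a b => by rw [Pi.neg_apply, Pi.neg_apply, Pi.neg_apply, Pi.neg_apply, abs_neg]; exact hK x y a b⟩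

omit [Fintype F] in
/-- Scalar multiple of a localised kernel is localised. -/
theorem Loc.smul (c : ℝ) {K : MKer D F} (hK : Loc K) : Loc (c • K) := by
  obtain ⟨p, q, C, δ, hδ, hK⟩ := hK
  refine ⟨p, q, |c| * C, δ, hδ, fun x y a b => ?_⟩
  simp only [Pi.smul_apply, smul_eq_mul]
  rw [abs_mul, mul_assoc]
  exact mul_le_mul_of_nonneg_left (hK x y a b) (abs_nonneg c)

omit [Fintype F] in
/-- The TRANSPOSE of a matrix-fibred kernel: `Kᵀ x y a b = K y x b a`. -/
def trK (K : MKer D F) : MKer D F := fun x y a b => K y x b a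

section TrK
omit [Fintype F]
/-- `trK` pointwise. -/
@[simp] theorem trK_apply (K : MKer D F) (x y : Fin D → ℤ) (a b : F) : trK K x y a b = K y x b a := rfl
/-- Transposition is an involution. -/
@[simp] theorem trK_trK (K : MKer D F) : trK (trK K) = K := rfl
/-- Transposition is additive. -/
theorem trK_add (K L : MKer D F) : trK (K + L) = trK K + trK L := rfl
/-- Transposition commutes with subtraction. -/
theorem trK_sub (K L : MKer D F) : trK (K - L) = trK K - trK L := rfl
/-- Transposition commutes with negation. -/
theorem trK_neg (K : MKer D F) : trK (-K) = -trK K := rfl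
/-- Transpose preserves `Decays` (the weight is symmetric). -/
theorem decays_trK {A : MKer D F} {C δ : ℝ} (h : Decays A C δ) : Decays (trK A) C δ := fun x y a b => by
  rw [trK_apply, ExpKernelCalculus.l1_sub_symm x y]; exact h y x b a
/-- Transpose swaps the localisation points of `BiLoc`. -/
theorem biLoc_trK {K : MKer D F} {p q : Fin D → ℤ} {C δ : ℝ} (h : BiLoc K p q C δ) : BiLoc (trK K) q p C δ :=
  fun x y a b => by rw [trK_apply, add_comm (l1 (x - q))]; exact h y x b a
/-- Transpose preserves the class `Spr`. -/
theorem Spr.trK {A : MKer D F} (h : Spr A) : Spr (trK A) := by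
  obtain ⟨C, δ, hδ, hA⟩ := h; exact ⟨C, δ, hδ, decays_trK hA⟩
/-- Transpose preserves the class `Loc` (localisation points swapped). -/
theorem Loc.trK {K : MKer D F} (h : Loc K) : Loc (trK K) := by
  obtain ⟨p, q, C, δ, hδ, hK⟩ := h; exact ⟨q, p, C, δ, hδ, biLoc_trK hK⟩
end TrK

/-- Transpose reverses composition — termwise, no summability needed. -/
theorem trK_comp (K L : MKer D F) : trK (comp K L) = comp (trK L) (trK K) := by
  funext x z a b
  show (∑' y, ∑ f, K z y b f * L y x f a) = ∑' y, ∑ f, trK L x y a f * trK K y z f b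
  exact tsum_congr fun y => Finset.sum_congr rfl fun f _ => by rw [trK_apply, trK_apply, mul_comm]

/-- The trace is transpose-invariant (termwise). -/
theorem tr_trK (K : MKer D F) : tr (trK K) = tr K := rfl

/-- Localised ∘ spread is localised (from `Spr.comp_loc` by transposition). -/
theorem Loc.comp_spr {K A : MKer D F} (hK : Loc K) (hA : Spr A) : Loc (ExpKernelCalculus.comp K A) := by
  have h := (hA.trK.comp_loc hK.trK).trK
  rwa [trK_comp, trK_trK, trK_trK] at h

/-! ## §2 The bricks: slices, associativity, cyclicity, additivity -/

omit [Fintype F] in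
/-- One middle-leg slice of `A ∘ K` is summable for tame factors (row majorant of `A`, bound of `K`). -/
theorem slice_tame {A K : MKer D F} (hA : Tame A) (hK : Tame K) (x z : Fin D → ℤ) (a f b : F) :
    Summable fun y : Fin D → ℤ => A x y a f * K y z f b := by
  obtain ⟨φ, hφ, hφ0, hle⟩ := hA.1 x
  obtain ⟨B, hB⟩ := hK.2.2
  refine Summable.of_norm_bounded (hφ.mul_right B) (fun y => ?_)
  rw [Real.norm_eq_abs, abs_mul]
  exact mul_le_mul (hle y a f) (hB y z f b) (abs_nonneg _) (hφ0 y)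

/-- Fibre-summed middle-leg slices of `A ∘ K` are summable for tame factors. -/
theorem slices_tame {A K : MKer D F} (hA : Tame A) (hK : Tame K) (x z : Fin D → ℤ) (a b : F) :
    Summable fun y : Fin D → ℤ => ∑ f, A x y a f * K y z f b :=
  summable_sum fun f _ => slice_tame hA hK x z a f b

/-- **ASSOCIATIVITY OF COMPOSITION FOR TAME FACTORS** (`KernelWard.comp_assoc_of_bound` with the majorant
`row(A)·bound(K) ⊗ column(L)`). -/
theorem comp_assoc_tame {A K L : MKer D F} (hA : Tame A) (hK : Tame K) (hL : Tame L) :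
    comp A (comp K L) = comp (comp A K) L := by
  refine comp_assoc_of_bound fun x w a b => ?_
  obtain ⟨φ, hφ, hφ0, hAle⟩ := hA.1 x
  obtain ⟨B, hB⟩ := hK.2.2
  obtain ⟨ψ, hψ, hψ0, hLle⟩ := hL.2.1 w
  have hB0 : 0 ≤ B := (abs_nonneg _).trans (hB x x a a)
  refine ⟨fun y => φ y * B, ψ, hφ.mul_right B, hψ, fun y => mul_nonneg (hφ0 y) hB0, hψ0, fun y z f g => ?_⟩
  rw [abs_mul, abs_mul]
  exact mul_le_mul (mul_le_mul (hAle y a f) (hB y z f g) (abs_nonneg _) (hφ0 y)) (hLle z g b) (abs_nonneg _)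
    (mul_nonneg (hφ0 y) hB0)

/-- **CYCLICITY OF THE TRACE, ONE LOCALISED AND ONE TAME FACTOR** (`KernelWard.tr_comp_comm_of_bound`). -/
theorem tr_comp_comm_loc {K L : MKer D F} (hK : Loc K) (hL : Tame L) : tr (comp K L) = tr (comp L K) := by
  obtain ⟨p, q, C, δ, hδ, hK⟩ := hK
  obtain ⟨B, hB⟩ := hL.2.2
  by_cases hF : Nonempty F
  · obtain ⟨a₀⟩ := hF
    have hB0 : 0 ≤ B := (abs_nonneg _).trans (hB p p a₀ a₀)
    refine tr_comp_comm_of_bound ⟨fun x => |C| * B * Real.exp (-δ * l1 (x - p)), fun y => Real.exp (-δ * l1 (y - q)),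
      (summable_exp_shift' hδ p).mul_left _, summable_exp_shift' hδ q, fun x => by positivity, fun y => by positivity,
      fun x y a f => ?_⟩
    have h1 : |K x y a f| ≤ |C| * Real.exp (-δ * l1 (x - p)) * Real.exp (-δ * l1 (y - q)) := by
      have := (biLoc_of_le hK le_rfl) x y a f
      rwa [show -δ * (l1 (x - p) + l1 (y - q)) = -δ * l1 (x - p) + -δ * l1 (y - q) by ring, Real.exp_add, ← mul_assoc] at this
    rw [abs_mul]
    calc |K x y a f| * |L y x f a| ≤ (|C| * Real.exp (-δ * l1 (x - p)) * Real.exp (-δ * l1 (y - q))) * B :=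
          mul_le_mul h1 (hB y x f a) (abs_nonneg _) (by positivity)
      _ = |C| * B * Real.exp (-δ * l1 (x - p)) * Real.exp (-δ * l1 (y - q)) := by ring
  · have hE : IsEmpty F := not_nonempty_iff.mp hF
    simp [ExpKernelCalculus.tr]

/-- `A ∘ (K + L) = A ∘ K + A ∘ L` for tame factors. -/
theorem comp_add_right_tame {A K L : MKer D F} (hA : Tame A) (hK : Tame K) (hL : Tame L) :
    comp A (K + L) = comp A K + comp A L := by
  funext x z a b
  show (∑' y, ∑ f, A x y a f * (K + L) y z f b) = (∑' y, ∑ f, A x y a f * K y z f b) + ∑' y, ∑ f, A x y a f * L y z f b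
  rw [← (slices_tame hA hK x z a b).tsum_add (slices_tame hA hL x z a b)]
  refine tsum_congr fun y => ?_
  rw [← Finset.sum_add_distrib]
  refine Finset.sum_congr rfl fun f _ => ?_
  simp only [Pi.add_apply]
  ring

/-- `(K + L) ∘ M = K ∘ M + L ∘ M` for tame factors. -/
theorem comp_add_left_tame {K L M : MKer D F} (hK : Tame K) (hL : Tame L) (hM : Tame M) :
    comp (K + L) M = comp K M + comp L M := by
  funext x z a b
  show (∑' y, ∑ f, (K + L) x y a f * M y z f b) = (∑' y, ∑ f, K x y a f * M y z f b) + ∑' y, ∑ f, L x y a f * M y z f b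
  rw [← (slices_tame hK hM x z a b).tsum_add (slices_tame hL hM x z a b)]
  refine tsum_congr fun y => ?_
  rw [← Finset.sum_add_distrib]
  refine Finset.sum_congr rfl fun f _ => ?_
  simp only [Pi.add_apply]
  ring

/-- `A ∘ (K − L) = A ∘ K − A ∘ L` for tame factors. -/
theorem comp_sub_right_tame {A K L : MKer D F} (hA : Tame A) (hK : Tame K) (hL : Tame L) :
    comp A (K - L) = comp A K - comp A L :=
  comp_sub_right (slices_tame hA hK) (slices_tame hA hL)

/-- `(K − L) ∘ M = K ∘ M − L ∘ M` for tame factors. -/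
theorem comp_sub_left_tame {K L M : MKer D F} (hK : Tame K) (hL : Tame L) (hM : Tame M) :
    comp (K - L) M = comp K M - comp L M :=
  comp_sub_left (slices_tame hK hM) (slices_tame hL hM)

/-- The trace series of a localised kernel converges absolutely. -/
theorem Loc.summable_tr {K : MKer D F} (hK : Loc K) : Summable fun x : Fin D → ℤ => ∑ a, K x x a a := by
  obtain ⟨p, q, C, δ, hδ, hK⟩ := hK
  exact summable_trTerm hK hδ

/-- `tr (K + L) = tr K + tr L` for localised kernels. -/
theorem tr_add_loc {K L : MKer D F} (hK : Loc K) (hL : Loc L) : tr (K + L) = tr K + tr L := by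
  show (∑' x, ∑ a, (K + L) x x a a) = (∑' x, ∑ a, K x x a a) + ∑' x, ∑ a, L x x a a
  rw [← hK.summable_tr.tsum_add hL.summable_tr]
  refine tsum_congr fun x => ?_
  rw [← Finset.sum_add_distrib]
  rfl

/-- `tr (K − L) = tr K − tr L` for localised kernels. -/
theorem tr_sub_loc {K L : MKer D F} (hK : Loc K) (hL : Loc L) : tr (K - L) = tr K - tr L :=
  tr_sub hK.summable_tr hL.summable_tr

/-- Additivity of the tadpole in the vertex (spread resolvent, localised vertices). -/
theorem tadpole_add {A W₁ W₂ : MKer D F} (hA : Spr A) (h₁ : Loc W₁) (h₂ : Loc W₂) :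
    tadpole A (W₁ + W₂) = tadpole A W₁ + tadpole A W₂ := by
  unfold ExpKernelCalculus.tadpole
  rw [comp_add_right_tame hA.tame h₁.tame h₂.tame, tr_add_loc (hA.comp_loc h₁) (hA.comp_loc h₂)]

/-- Additivity of the bubble in the first vertex. -/
theorem bubble_add_left {A V₁ V₂ Z : MKer D F} (hA : Spr A) (h₁ : Loc V₁) (h₂ : Loc V₂) (hZ : Loc Z) :
    bubble A (V₁ + V₂) Z = bubble A V₁ Z + bubble A V₂ Z := by
  unfold ExpKernelCalculus.bubble
  rw [comp_add_right_tame hA.tame h₁.tame h₂.tame,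
    comp_add_left_tame (hA.comp_loc h₁).tame (hA.comp_loc h₂).tame (hA.comp_loc hZ).tame,
    tr_add_loc ((hA.comp_loc h₁).comp (hA.comp_loc hZ)) ((hA.comp_loc h₂).comp (hA.comp_loc hZ))]

/-- Additivity of the bubble in the second vertex. -/
theorem bubble_add_right {A Y Z₁ Z₂ : MKer D F} (hA : Spr A) (hY : Loc Y) (h₁ : Loc Z₁) (h₂ : Loc Z₂) :
    bubble A Y (Z₁ + Z₂) = bubble A Y Z₁ + bubble A Y Z₂ := by
  unfold ExpKernelCalculus.bubble
  rw [comp_add_right_tame hA.tame h₁.tame h₂.tame,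
    comp_add_right_tame (hA.comp_loc hY).tame (hA.comp_loc h₁).tame (hA.comp_loc h₂).tame,
    tr_add_loc ((hA.comp_loc hY).comp (hA.comp_loc h₁)) ((hA.comp_loc hY).comp (hA.comp_loc h₂))]

/-- `(−X) ∘ M = −(X ∘ M)` — termwise, no summability needed. -/
theorem comp_neg_left (X M : MKer D F) : comp (-X) M = -comp X M := by
  funext x z a b
  show (∑' y, ∑ f, (-X) x y a f * M y z f b) = -(∑' y, ∑ f, X x y a f * M y z f b)
  rw [← tsum_neg]
  refine tsum_congr fun y => ?_
  rw [← Finset.sum_neg_distrib]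
  refine Finset.sum_congr rfl fun f _ => ?_
  simp only [Pi.neg_apply, neg_mul]

/-- `M ∘ (−X) = −(M ∘ X)` — termwise, no summability needed. -/
theorem comp_neg_right (M X : MKer D F) : comp M (-X) = -comp M X := by
  funext x z a b
  show (∑' y, ∑ f, M x y a f * (-X) y z f b) = -(∑' y, ∑ f, M x y a f * X y z f b)
  rw [← tsum_neg]
  refine tsum_congr fun y => ?_
  rw [← Finset.sum_neg_distrib]
  refine Finset.sum_congr rfl fun f _ => ?_
  simp only [Pi.neg_apply, mul_neg]

end

end Summit.QuantumFields.BalabanUV.Beta.TameKernelCalculus
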